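import Mathlib
import Summits.Ventures.HodgeRepro.Tier4.Line1.RTFSetting
import Summits.Ventures.HodgeRepro.Tier4.Line1.KernelSupportFinite
import Summits.Ventures.HodgeRepro.Tier4.Line1.KernelUnfold
import Summits.Ventures.HodgeRepro.Tier4.Line1.KernelOperator
import Summits.Ventures.HodgeRepro.Tier4.Line1.KernelEigen
import Summits.Ventures.HodgeRepro.Tier4.Line1.KernelTranslate

/-!
# Tier4/Line1/KernelNondegenerate — LINE L1, J1 rung (4a): non-degeneracy of the kernel action

Blind re-derivation cell `pub-hodge-repro`, Tier 4 «prove the step» (README §9–§10), seat t4-L1-p1 (prover, gen 0),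
the lead's cut S12414 on LINE L1 (the RTF line): no non-zero `ψ ∈ L²(DG)` is killed by every kernel operator `K_f`,
`f` a test function — the half of J1's rung (4) that is Mathlib-level (the other half, the `G`-invariant irreducible
refinement, is the declared wall).  The statement is t4-plan-1's typing (J1-rung4-sig.lean, S12436 (3)) with ONE
addition: `[LocallyCompactSpace G]` beside `[SecondCountableTopology G]` — the proof uses Mathlib's continuity of
`Lp.compMeasurePreserving` in the measure-preserving map, which needs the Haar measure regular and locally finite, and
Mathlib provides both only on a locally compact second countable group (`Measure.regular_of_isMulLeftInvariant`);
the adelic instance has both.  The translation action and its continuity live in `Tier4/Line1/KernelTranslate.lean`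
(imported by name).  No `sorry`; axioms = the trio.

THE MATHEMATICS (everything on `G`; no invariant extension of the class `ψ` to the quotient is needed).  Let `D ⊆ DG`
be a measurable core (`D =ᵐ DG`) and `ψ₀ := 1_D ψ ∈ L²(G, μ)`, `ψ₀ ≠ 0`.  For a rational `γ` and `g ∈ G` let
`ψ₀^{γ,g}(x) := ψ₀(γ⁻¹ x g)` (`translLp`; the translation preserves `μ` by left invariance and `rightInv`).
* `g ↦ ⟨ψ₀, ψ₀^{γ,g}⟩_{L²(G)}` is continuous (`continuous_inner_translLp`: `Lp.compMeasurePreserving_continuous`,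
  the Haar measure being regular and locally finite).
* `F(g) := ∑_{γ ∈ Γ} ⟨ψ₀, ψ₀^{γ,g}⟩` over the finitely many rational `γ ∈ closure DG · N₀ · (closure DG)⁻¹` (`N₀` a
  compact neighbourhood of `1`; `finite_of_subset_compact`) is continuous with `F(1) = ‖ψ₀‖² > 0`: the terms with
  `γ ≠ 1` vanish at `g = 1` because `DG ∩ γ DG` is null (`IsFundamentalDomain.aedisjoint`).
* THE PAIRING IDENTITY (`pairing_eq_integral`): for a test function `f` supported in `N₀`,
  `⟨K_f ψ, ψ⟩_{L²(DG)} = ∫_G f(g) F(g) dμ(g)` — unfold the kernel at `x ∈ D` along the finitely many contributing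
  `γ` (`kernelOp_eq_sum_integral`), change variables `z = γ⁻¹ x g` (left invariance), and swap the integrals
  (Fubini; `integrable_pairing`: `f` bounded with compact support, `ψ₀ ∈ L²(G)`, `ψ ∈ L²(DG)`, `ab ≤ (a² + b²)/2`).
* The test function: `f := (∫ g₀)⁻¹ g₀` for a Urysohn bump `g₀ ≥ 0` at `1` supported in an open `V ⊆ N₀` on which
  `Re F > ‖ψ₀‖²/2` (continuity of `F`).  Then `Re ⟨K_f ψ, ψ⟩ = ∫ f · Re F ≥ ‖ψ₀‖²/2 > 0`, so `K_f ψ ≠ 0` a.e.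

Nothing here says anything about the status of the Hodge conjecture for CM abelian varieties, which is NOT proved
(HC_CM is NOT proved by anyone in this repository).
-/

set_option autoImplicit false

noncomputable section

namespace Summit.Ventures.HodgeRepro.Tier4.Line1

open MeasureTheory Topology
open scoped Pointwise

namespace RTF

variable {G : Type} [Group G] [TopologicalSpace G] [IsTopologicalGroup G] [MeasurableSpace G]
  [BorelSpace G]

namespace Setting

variable (S : Setting G)

/-- for `x ∈ D`, the kernel operator unfolds along the finitely many contributing rational points, with the change of
variables `z = γ⁻¹ x g` in each term (left invariance of the Haar measure). -/
theorem kernelOp_eq_sum_integral {D : Set G} (hD : D ⊆ S.DG) (hDm : MeasurableSet D)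
    (hres : S.μ.restrict D = S.μ.restrict S.DG) {ψ : G → ℂ} (hψ : Integrable ψ (S.μ.restrict S.DG))
    {N : Set G} (Γ : Finset S.Gk)
    (hΓ : ∀ γ : S.Gk, ∀ x ∈ closure S.DG, ∀ g ∈ N, ∀ y ∈ closure S.DG, (γ : G) = x * g * y⁻¹ → γ ∈ Γ)
    {f : G → ℂ} (hf : IsTest f) (hfN : tsupport f ⊆ N) {x : G} (hx : x ∈ D) :
    S.kernelOp f ψ x = ∑ γ ∈ Γ, ∫ g, f g * D.indicator ψ ((γ : G)⁻¹ * x * g) ∂S.μ := by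
  haveI : S.μ.IsHaarMeasure := S.haar
  obtain ⟨C, -, hC⟩ := exists_bound_of_isTest hf
  have hψ₀ : Integrable (D.indicator ψ) S.μ := by
    rw [integrable_indicator_iff hDm, IntegrableOn, hres]
    exact hψ
  have hker : ∀ z ∈ D, S.kernel f x z = ∑ γ ∈ Γ, f (x⁻¹ * γ * z) := by
    intro z hz
    unfold kernel
    apply tsum_eq_sum
    intro γ hγ
    by_contra hne
    exact hγ (hΓ γ x (subset_closure (hD hx)) _ (hfN (subset_tsupport f hne)) z
      (subset_closure (hD hz)) (by show (γ : G) = x * (x⁻¹ * γ * z) * z⁻¹; group))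
  unfold kernelOp
  calc ∫ z, S.kernel f x z * ψ z ∂(S.μ.restrict S.DG)
      = ∫ z, D.indicator (fun z => S.kernel f x z * ψ z) z ∂S.μ := by
        rw [← hres, integral_indicator hDm]
    _ = ∫ z, ∑ γ ∈ Γ, f (x⁻¹ * γ * z) * D.indicator ψ z ∂S.μ := by
        congr 1
        funext z
        by_cases hz : z ∈ D
        · rw [Set.indicator_of_mem hz, Set.indicator_of_mem hz, hker z hz, Finset.sum_mul]
        · rw [Set.indicator_of_notMem hz, Set.indicator_of_notMem hz]
          simp
    _ = ∑ γ ∈ Γ, ∫ z, f (x⁻¹ * γ * z) * D.indicator ψ z ∂S.μ := by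
        refine integral_finsetSum _ fun γ _ => ?_
        refine hψ₀.bdd_mul (c := C) ?_ (Filter.Eventually.of_forall fun z => hC _)
        exact (hf.cont.comp (continuous_const.mul continuous_id)).aestronglyMeasurable
    _ = ∑ γ ∈ Γ, ∫ g, f g * D.indicator ψ ((γ : G)⁻¹ * x * g) ∂S.μ := by
        refine Finset.sum_congr rfl fun γ _ => ?_
        rw [← integral_mul_left_eq_self (fun u => f u * D.indicator ψ ((γ : G)⁻¹ * x * u)) (x⁻¹ * γ)]
        congr 1
        funext u
        have hu : (γ : G)⁻¹ * x * (x⁻¹ * γ * u) = u := by group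
        rw [hu]

/-- Fubini's integrability for the pairing: the integrand `(x, g) ↦ f(g) ψ₀(γ⁻¹ x g) conj ψ(x)` on `DG × G`
(`f` bounded with compact support, `ψ₀ ∈ L²(G)`, `ψ ∈ L²(DG)`; the bound `ab ≤ (a² + b²)/2`). -/
theorem integrable_pairing [LocallyCompactSpace G] [SecondCountableTopology G] {D : Set G}
    (ψ : Lp ℂ 2 (S.μ.restrict S.DG)) (hψ₀ : MemLp (D.indicator ⇑ψ) 2 S.μ) {f : G → ℂ} (hf : IsTest f)
    (γ : S.Gk) :
    Integrable (fun p : G × G =>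
        f p.2 * D.indicator ψ ((γ : G)⁻¹ * p.1 * p.2) * starRingEnd ℂ (ψ p.1))
      ((S.μ.restrict S.DG).prod S.μ) := by
  haveI : S.μ.IsHaarMeasure := S.haar
  haveI : IsFiniteMeasure (S.μ.restrict S.DG) := S.isFiniteMeasure_restrict_DG
  have hmeas : AEStronglyMeasurable (fun p : G × G =>
      f p.2 * D.indicator ψ ((γ : G)⁻¹ * p.1 * p.2) * starRingEnd ℂ (ψ p.1))
      ((S.μ.restrict S.DG).prod S.μ) := by
    have h1 : AEStronglyMeasurable (fun p : G × G => f p.2) ((S.μ.restrict S.DG).prod S.μ) :=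
      (hf.cont.comp continuous_snd).aestronglyMeasurable
    have hqmp : Measure.QuasiMeasurePreserving (fun p : G × G => (γ : G)⁻¹ * p.1 * p.2)
        ((S.μ.restrict S.DG).prod S.μ) S.μ := by
      have heq : (fun p : G × G => (γ : G)⁻¹ * p.1 * p.2) =
          (fun y : G => (γ : G)⁻¹ * y) ∘ Prod.snd ∘ (fun z : G × G => (z.1, z.1 * z.2)) := by
        funext p
        simp [mul_assoc]
      rw [heq]
      exact (measurePreserving_mul_left S.μ (γ : G)⁻¹).quasiMeasurePreserving.comp
        (Measure.quasiMeasurePreserving_snd.comp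
          (MeasureTheory.measurePreserving_prod_mul (S.μ.restrict S.DG) S.μ).quasiMeasurePreserving)
    have h2 : AEStronglyMeasurable (fun p : G × G => D.indicator ψ ((γ : G)⁻¹ * p.1 * p.2))
        ((S.μ.restrict S.DG).prod S.μ) :=
      hψ₀.aestronglyMeasurable.comp_quasiMeasurePreserving hqmp
    have h3 : AEStronglyMeasurable (fun p : G × G => starRingEnd ℂ (ψ p.1))
        ((S.μ.restrict S.DG).prod S.μ) :=
      Complex.continuous_conj.comp_aestronglyMeasurable
        ((Lp.aestronglyMeasurable ψ).comp_quasiMeasurePreserving Measure.quasiMeasurePreserving_fst)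
    exact (h1.mul h2).mul h3
  have hfL : MemLp f 2 S.μ := hf.cont.memLp_of_hasCompactSupport hf.compact
  have hψL : ∀ x : G, MemLp (fun g => D.indicator ψ ((γ : G)⁻¹ * x * g)) 2 S.μ := fun x =>
    hψ₀.comp_measurePreserving (measurePreserving_mul_left S.μ ((γ : G)⁻¹ * x))
  rw [integrable_prod_iff hmeas]
  refine ⟨Filter.Eventually.of_forall fun x => ?_, ?_⟩
  · have h := (hfL.integrable_mul (hψL x)).mul_const (starRingEnd ℂ (ψ x))
    refine h.congr (Filter.Eventually.of_forall fun g => ?_)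
    rfl
  · have hψint : Integrable (fun x => ‖ψ x‖) (S.μ.restrict S.DG) :=
      ((Lp.memLp ψ).integrable one_le_two).norm
    have hfsq : Integrable (fun g => ‖f g‖ ^ 2) S.μ :=
      (memLp_two_iff_integrable_sq_norm hfL.1).mp hfL
    have hψsq : ∀ x : G, Integrable (fun g => ‖D.indicator ψ ((γ : G)⁻¹ * x * g)‖ ^ 2) S.μ := fun x =>
      (memLp_two_iff_integrable_sq_norm (hψL x).1).mp (hψL x)
    have hψsq' : ∀ x : G, ∫ g, ‖D.indicator ψ ((γ : G)⁻¹ * x * g)‖ ^ 2 ∂S.μ =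
        ∫ u, ‖D.indicator ψ u‖ ^ 2 ∂S.μ := fun x =>
      (measurePreserving_mul_left S.μ ((γ : G)⁻¹ * x)).integral_comp
        (MeasurableEquiv.mulLeft ((γ : G)⁻¹ * x)).measurableEmbedding (fun u => ‖D.indicator ψ u‖ ^ 2)
    refine Integrable.mono' (g := fun x => ‖ψ x‖ *
      ((∫ g, ‖f g‖ ^ 2 ∂S.μ + ∫ u, ‖D.indicator ψ u‖ ^ 2 ∂S.μ) / 2)) (hψint.mul_const _)
      hmeas.norm.integral_prod_right' (Filter.Eventually.of_forall fun x => ?_)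
    rw [Real.norm_of_nonneg (integral_nonneg fun g => norm_nonneg _)]
    calc ∫ g, ‖f g * D.indicator ψ ((γ : G)⁻¹ * x * g) * starRingEnd ℂ (ψ x)‖ ∂S.μ
        = ∫ g, (‖f g‖ * ‖D.indicator ψ ((γ : G)⁻¹ * x * g)‖) * ‖ψ x‖ ∂S.μ := by
          congr 1
          funext g
          rw [norm_mul, norm_mul, RCLike.norm_conj]
      _ ≤ ∫ g, ((‖f g‖ ^ 2 + ‖D.indicator ψ ((γ : G)⁻¹ * x * g)‖ ^ 2) / 2) * ‖ψ x‖ ∂S.μ := by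
          refine integral_mono_of_nonneg (Filter.Eventually.of_forall fun g => by positivity)
            (((hfsq.add (hψsq x)).div_const 2).mul_const _)
            (Filter.Eventually.of_forall fun g => ?_)
          have h2 := two_mul_le_add_sq ‖f g‖ ‖D.indicator ψ ((γ : G)⁻¹ * x * g)‖
          have hc : 0 ≤ ‖ψ x‖ := norm_nonneg _
          nlinarith
      _ = ‖ψ x‖ * ((∫ g, ‖f g‖ ^ 2 ∂S.μ + ∫ u, ‖D.indicator ψ u‖ ^ 2 ∂S.μ) / 2) := by
          rw [integral_mul_const, integral_div, integral_add hfsq (hψsq x), hψsq' x, mul_comm]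

/-- THE PAIRING IDENTITY: `⟨K_f ψ, ψ⟩_{L²(DG)} = ∫_G f(g) F(g) dμ(g)` with
`F(g) = ∑_{γ ∈ Γ} ⟨ψ₀, ψ₀(γ⁻¹ · g)⟩_{L²(G)}`, for `f` supported in `N` and `Γ` containing every rational point of
`closure DG · N · (closure DG)⁻¹` (unfold the kernel at `x ∈ D`, change variables, Fubini). -/
theorem pairing_eq_integral [LocallyCompactSpace G] [SecondCountableTopology G] {D : Set G}
    (hD : D ⊆ S.DG) (hDm : MeasurableSet D) (hres : S.μ.restrict D = S.μ.restrict S.DG)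
    (ψ : Lp ℂ 2 (S.μ.restrict S.DG)) (hψ₀ : MemLp (D.indicator ⇑ψ) 2 S.μ) {N : Set G}
    (Γ : Finset S.Gk)
    (hΓ : ∀ γ : S.Gk, ∀ x ∈ closure S.DG, ∀ g ∈ N, ∀ y ∈ closure S.DG, (γ : G) = x * g * y⁻¹ → γ ∈ Γ)
    {f : G → ℂ} (hf : IsTest f) (hfN : tsupport f ⊆ N) :
    ∫ x, S.kernelOp f ψ x * starRingEnd ℂ (ψ x) ∂(S.μ.restrict S.DG) =
      ∫ g, f g * ∑ γ ∈ Γ, Inner.inner ℂ (hψ₀.toLp _) (S.translLp (hψ₀.toLp _) γ g) ∂S.μ := by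
  haveI : S.μ.IsHaarMeasure := S.haar
  haveI : IsFiniteMeasure (S.μ.restrict S.DG) := S.isFiniteMeasure_restrict_DG
  have hψint : Integrable ψ (S.μ.restrict S.DG) := (Lp.memLp ψ).integrable one_le_two
  have hxD : ∀ᵐ x ∂(S.μ.restrict S.DG), x ∈ D := by
    rw [← hres]
    exact ae_restrict_mem hDm
  have h1 : (fun x => S.kernelOp f ψ x * starRingEnd ℂ (ψ x)) =ᵐ[S.μ.restrict S.DG]
      fun x => ∑ γ ∈ Γ, ∫ g, f g * D.indicator ψ ((γ : G)⁻¹ * x * g) * starRingEnd ℂ (ψ x) ∂S.μ := by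
    filter_upwards [hxD] with x hx
    rw [S.kernelOp_eq_sum_integral hD hDm hres hψint Γ hΓ hf hfN hx, Finset.sum_mul]
    refine Finset.sum_congr rfl fun γ _ => ?_
    exact (integral_mul_const _ _).symm
  have h2 : ∀ γ ∈ Γ,
      ∫ x, ∫ g, f g * D.indicator ψ ((γ : G)⁻¹ * x * g) * starRingEnd ℂ (ψ x) ∂S.μ
          ∂(S.μ.restrict S.DG)
        = ∫ g, f g * Inner.inner ℂ (hψ₀.toLp _) (S.translLp (hψ₀.toLp _) γ g) ∂S.μ := by
    intro γ _
    rw [integral_integral_swap (S.integrable_pairing ψ hψ₀ hf γ)]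
    congr 1
    funext g
    rw [S.inner_translLp_eq_integral hDm hres ψ hψ₀ γ g, ← integral_const_mul]
    congr 1
    funext x
    ring
  rw [integral_congr_ae h1, integral_finsetSum _ fun γ _ => (S.integrable_pairing ψ hψ₀ hf γ).integral_prod_left,
    Finset.sum_congr rfl h2, ← integral_finsetSum]
  · congr 1
    funext g
    rw [Finset.mul_sum]
  · intro γ _
    exact (hf.cont.mul (S.continuous_inner_translLp _ _ γ)).integrable_of_hasCompactSupport
      hf.compact.mul_right

/-- (J1-(4a), prover-facing, M — the lead's cut S12414, module Tier4/Line1/KernelNondegenerate.lean, t4-L1-p1):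
**non-degeneracy of the kernel action** — no non-zero `ψ ∈ L²(DG)` is killed by every `R(f)`: an approximate identity
(a test function concentrated near `1` with integral `1`) moves `ψ` by less than `‖ψ‖/2` in `L²` (continuity of
translation in `L²`: density of compactly supported continuous functions). The `f` must be exhibited from `ψ`. -/
theorem kernelOp_nondegenerate [LocallyCompactSpace G] [SecondCountableTopology G] :
    ∀ ψ : Lp ℂ 2 (S.μ.restrict S.DG), ψ ≠ 0 →
      ∃ f : G → ℂ, IsTest f ∧ ¬ (S.kernelOp f ψ =ᵐ[S.μ.restrict S.DG] 0) := by
  classical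
  intro ψ hψ
  haveI : S.μ.IsHaarMeasure := S.haar
  haveI : IsFiniteMeasure (S.μ.restrict S.DG) := S.isFiniteMeasure_restrict_DG
  -- the measurable core `D ⊆ DG`
  obtain ⟨D, hD, hDm, hDae⟩ := S.fdG.nullMeasurableSet.exists_measurable_subset_ae_eq
  have hres : S.μ.restrict D = S.μ.restrict S.DG := Measure.restrict_congr_set hDae
  have hψ₀ : MemLp (D.indicator ⇑ψ) 2 S.μ := by
    rw [memLp_indicator_iff_restrict hDm, hres]
    exact Lp.memLp ψ
  -- `ψ₀ ≠ 0` in `L²(G)`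
  have hψ₀ne : (hψ₀.toLp _ : Lp ℂ 2 S.μ) ≠ 0 := by
    intro h0
    apply hψ
    rw [Lp.eq_zero_iff_ae_eq_zero] at h0 ⊢
    have h1 : D.indicator ⇑ψ =ᵐ[S.μ] 0 := (MemLp.coeFn_toLp hψ₀).symm.trans h0
    have h2 : ⇑ψ =ᵐ[S.μ.restrict D] 0 := by
      rw [Filter.EventuallyEq, ae_restrict_iff' hDm]
      filter_upwards [h1] with x hx hxD
      rw [Set.indicator_of_mem hxD] at hx
      exact hx
    rw [hres] at h2
    exact h2
  -- a compact neighbourhood `N₀` of `1`; the finite set `Γ` of rational points in `closure DG · N₀ · (closure DG)⁻¹`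
  obtain ⟨N₀, hN₀c, hN₀n⟩ := exists_compact_mem_nhds (1 : G)
  have hK : IsCompact ((fun p : G × G × G => p.1 * p.2.1 * p.2.2⁻¹) ''
      (closure S.DG ×ˢ N₀ ×ˢ closure S.DG)) :=
    (S.compG.prod (hN₀c.prod S.compG)).image
      ((continuous_fst.mul (continuous_fst.comp continuous_snd)).mul
        (continuous_snd.comp continuous_snd).inv)
  have hΓfin : {γ : S.Gk | ∃ x ∈ closure S.DG, ∃ g ∈ N₀, ∃ y ∈ closure S.DG,
      (γ : G) = x * g * y⁻¹}.Finite := by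
    refine S.finite_of_subset_compact hK ?_
    rintro γ ⟨x, hx, g, hg, y, hy, hγ⟩
    exact ⟨(x, g, y), ⟨hx, hg, hy⟩, hγ.symm⟩
  set Γ : Finset S.Gk := insert (1 : S.Gk) hΓfin.toFinset with hΓdef
  have hΓ : ∀ γ : S.Gk, ∀ x ∈ closure S.DG, ∀ g ∈ N₀, ∀ y ∈ closure S.DG,
      (γ : G) = x * g * y⁻¹ → γ ∈ Γ := by
    intro γ x hx g hg y hy h
    exact Finset.mem_insert_of_mem (hΓfin.mem_toFinset.mpr ⟨x, hx, g, hg, y, hy, h⟩)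
  -- the continuous function `F`, with `F 1 = ‖ψ₀‖²`
  set F : G → ℂ := fun g => ∑ γ ∈ Γ, Inner.inner ℂ (hψ₀.toLp _) (S.translLp (hψ₀.toLp _) γ g)
    with hFdef
  have hFc : Continuous F :=
    continuous_finsetSum _ fun γ _ => S.continuous_inner_translLp _ _ γ
  have hF1 : F 1 = ((‖(hψ₀.toLp _ : Lp ℂ 2 S.μ)‖ : ℝ) : ℂ) ^ 2 := by
    simp only [hFdef]
    rw [Finset.sum_eq_single (1 : S.Gk)]
    · rw [S.translLp_one_one, inner_self_eq_norm_sq_to_K]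
      rfl
    · intro γ _ hγ
      exact S.inner_translLp_one_eq_zero hD hψ₀ hγ
    · intro h
      exact absurd (Finset.mem_insert_self 1 _) h
  have hnorm_pos : 0 < ‖(hψ₀.toLp _ : Lp ℂ 2 S.μ)‖ ^ 2 := by
    have := norm_pos_iff.mpr hψ₀ne
    positivity
  -- the open set where `Re F > ‖ψ₀‖² / 2`, intersected with `N₀`
  have hRe : Continuous fun g => (F g).re := Complex.continuous_re.comp hFc
  have hN₁ : {g : G | ‖(hψ₀.toLp _ : Lp ℂ 2 S.μ)‖ ^ 2 / 2 < (F g).re} ∈ 𝓝 (1 : G) := by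
    refine (isOpen_lt continuous_const hRe).mem_nhds ?_
    show ‖(hψ₀.toLp _ : Lp ℂ 2 S.μ)‖ ^ 2 / 2 < (F 1).re
    rw [hF1, ← Complex.ofReal_pow, Complex.ofReal_re]
    linarith
  obtain ⟨V, hVsub, hVo, h1V⟩ := mem_nhds_iff.mp (Filter.inter_mem hN₀n hN₁)
  -- the bump `g₀` at `1` supported in `V`
  obtain ⟨g₀, hg₀1, hg₀c, hg₀V, hg₀01⟩ :=
    exists_continuousMap_one_of_isCompact_subset_isOpen isCompact_singleton hVo
      (Set.singleton_subset_iff.mpr h1V)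
  have hg₀cs : HasCompactSupport (⇑g₀) := hg₀c
  have hg₀int : Integrable (⇑g₀) S.μ := g₀.continuous.integrable_of_hasCompactSupport hg₀cs
  have hI₀ : 0 < ∫ x, g₀ x ∂S.μ := by
    refine (integral_pos_iff_support_of_nonneg (fun x => (hg₀01 x).1) hg₀int).mpr ?_
    refine g₀.continuous.isOpen_support.measure_pos S.μ ⟨1, ?_⟩
    rw [Function.mem_support, hg₀1 (Set.mem_singleton _)]
    exact one_ne_zero
  -- the test function `f := (∫ g₀)⁻¹ · g₀`, viewed in `ℂ`
  set f : G → ℂ := fun x => (((∫ y, g₀ y ∂S.μ)⁻¹ * g₀ x : ℝ) : ℂ) with hfdef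
  have hf : IsTest f :=
    ⟨Complex.continuous_ofReal.comp (continuous_const.mul g₀.continuous),
      (hg₀cs.mul_left (f := fun _ => (∫ y, g₀ y ∂S.μ)⁻¹)).comp_left Complex.ofReal_zero⟩
  have hfN : tsupport f ⊆ N₀ := by
    refine ((tsupport_comp_subset Complex.ofReal_zero _).trans ?_).trans
      (hg₀V.trans (hVsub.trans Set.inter_subset_left))
    exact closure_mono (Function.support_mul_subset_right _ _)
  refine ⟨f, hf, ?_⟩
  intro hzero
  -- the pairing vanishes …
  have hpair : ∫ x, S.kernelOp f ψ x * starRingEnd ℂ (ψ x) ∂(S.μ.restrict S.DG) = 0 := by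
    refine integral_eq_zero_of_ae ?_
    filter_upwards [hzero] with x hx
    rw [hx, Pi.zero_apply, zero_mul]
  -- … but it equals `∫ f F`, whose real part is `≥ ‖ψ₀‖² / 2 > 0`
  rw [S.pairing_eq_integral hD hDm hres ψ hψ₀ Γ hΓ hf hfN] at hpair
  have hint : Integrable (fun g => f g * F g) S.μ :=
    (hf.cont.mul hFc).integrable_of_hasCompactSupport hf.compact.mul_right
  have hre := integral_re hint
  simp only [RCLike.re_to_complex] at hre
  rw [hpair, Complex.zero_re] at hre
  have hlow : ∫ g, ((∫ y, g₀ y ∂S.μ)⁻¹ * g₀ g) * (‖(hψ₀.toLp _ : Lp ℂ 2 S.μ)‖ ^ 2 / 2) ∂S.μ ≤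
      ∫ g, (f g * F g).re ∂S.μ := by
    refine integral_mono ((hg₀int.const_mul _).mul_const _) hint.re fun g => ?_
    show ((∫ y, g₀ y ∂S.μ)⁻¹ * g₀ g) * (‖(hψ₀.toLp _ : Lp ℂ 2 S.μ)‖ ^ 2 / 2) ≤
      ((((∫ y, g₀ y ∂S.μ)⁻¹ * g₀ g : ℝ) : ℂ) * F g).re
    rw [Complex.re_ofReal_mul]
    by_cases hg : g₀ g = 0
    · rw [hg]
      simp
    · have hgV : g ∈ V := hg₀V (subset_tsupport _ hg)
      have hlt := (hVsub hgV).2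
      have hnn : 0 ≤ (∫ y, g₀ y ∂S.μ)⁻¹ * g₀ g := mul_nonneg (inv_nonneg.mpr hI₀.le) (hg₀01 g).1
      exact mul_le_mul_of_nonneg_left (le_of_lt hlt) hnn
  have hval : ∫ g, ((∫ y, g₀ y ∂S.μ)⁻¹ * g₀ g) * (‖(hψ₀.toLp _ : Lp ℂ 2 S.μ)‖ ^ 2 / 2) ∂S.μ =
      ‖(hψ₀.toLp _ : Lp ℂ 2 S.μ)‖ ^ 2 / 2 := by
    rw [integral_mul_const, integral_const_mul, inv_mul_cancel₀ hI₀.ne', one_mul]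
  rw [hval, hre] at hlow
  linarith

end Setting

end RTF

end Summit.Ventures.HodgeRepro.Tier4.Line1

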